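import Summits.Ventures.HodgeRepro2.T5InertIsotropicLines

/-!
# The degree of the cell `K aₙ K`: `deg Tₙ = (Q q + 1) · q · (Q q²)^{n−1}`
(cell pub-hodge-repro2, seat p3)

Tier-5 N3 support — THE COUNT OF T5-SATAKE-KERNEL-p3.md ROW 11 IN KERNEL FORM (files 195–200 assembled).
Write `Q = #𝔽` for the residue field of `R` and `q = #{t ∈ 𝔽 : t + t̄ = 0}` for its trace-zero part. The
tower `K ⊃ K_{1,1} ⊃ K_{1,2} ⊃ K_{2,4} ⊃ … ⊃ K_{n,2n} = K ∩ aₙ K aₙ⁻¹` has the steps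

* `[K : K_{1,1}] = Q q + 1` (file 200, the isotropic lines),
* `[K_{1,1} : K_{1,2}] = [N_{1,1} : N_{1,2}] = q` (files 198 + 196),
* **`relIndex_congSubgroup_succ`** — `[K_{m,2m} : K_{m+1,2m+2}] = [N_{m,2m} : N_{m+1,2m+2}] = Q q²` for `m ≥ 1`
  (files 198 + 196 through `N_{m,2m} ⊃ N_{m+1,2m} ⊃ N_{m+1,2m+1} ⊃ N_{m+1,2m+2}`),

hence **`relIndex_congSubgroup_cell`** `[K : K_{n,2n}] = (Q q + 1) q (Q q²)^{n−1}` and, with file 193's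
`deg Tₙ = [K : K ∩ aₙ K aₙ⁻¹]`, **`ncard_orbit_cellU_eq`**: `deg Tₙ = #(K aₙ K / K) = (Q q + 1) q (Q q²)^{n−1}`
for `n ≥ 1`. Once `Q = q²` (the residue involution non-trivial — the inert case, next file) this is the printed
`(q³ + 1) q^{4n−3}`, and the degree sequence `deg T₁ = q⁴ + q`, `deg T_{n+1} = q⁴ deg Tₙ` of file 192 follows.

Hypotheses: p8's standing ones for the local package (`R` a DVR with finite residue field, `E = Frac R`, the
integrality-preserving involution, the star-fixed unit `u`, the uniformiser `ϖ` with star-fixed image) and the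
trace lift `htr : ∃ e ∈ R, e + ē = 1`.

Mathlib + this seat's file 200 and its imports; no display; no device.
§8(d): uses an L-value-free non-vanishing device: NO.
-/

namespace Summit.Ventures.HodgeRepro2.T5InertDegreeCount

open Summit.Ventures.HodgeRepro2.T5HermitianThreeElements Summit.Ventures.HodgeRepro2.T5UnitaryGroupForm
  Summit.Ventures.HodgeRepro2.T5UnitaryHeckeAdjoint Summit.Ventures.HodgeRepro2.T5HeckeBasisCells
  Summit.Ventures.HodgeRepro2.T5HeckeDegreeIndex Summit.Ventures.HodgeRepro2.T5InertCongruenceSubgroup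
  Summit.Ventures.HodgeRepro2.T5InertUnipotentCongruence Summit.Ventures.HodgeRepro2.T5InertCongruenceSubgroups
  Summit.Ventures.HodgeRepro2.T5InertIwahoriFactorisation Summit.Ventures.HodgeRepro2.T5InertUnipotentResidue
  Summit.Ventures.HodgeRepro2.T5InertIsotropicLines

section Count

variable {R E : Type*} [CommRing R] [IsDomain R] [IsDiscreteValuationRing R] [Field E] [StarRing E]
  [Algebra R E] [IsFractionRing R E]
  (hstar : ∀ x : E, IsLocalization.IsInteger R x → IsLocalization.IsInteger R (star x))
  (u : E) (hsu : star u = u) (hu0 : u ≠ 0) (hu : IsLocalization.IsInteger R u)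
  (hu' : IsLocalization.IsInteger R u⁻¹)
  {ϖ : R} (hϖ : Irreducible ϖ) (hs : star (algebraMap R E ϖ) = algebraMap R E ϖ)

omit [IsDomain R] [IsDiscreteValuationRing R] [IsFractionRing R E] in
/-- `N_{a',b'} ≤ N_{a,b}` for `a ≤ a'`, `b ≤ b'`. -/
theorem unipCong_mono {a b a' b' : ℕ} {hba : b ≤ 2 * a} {hba' : b' ≤ 2 * a'} (ha : a ≤ a') (hb : b ≤ b') :
    unipCong hstar u hu' hs a' b' hba' ≤ unipCong hstar u hu' hs a b hba := by
  rintro g ⟨x, z, hg⟩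
  exact ⟨ϖ ^ (a' - a) * x, ϖ ^ (b' - b) * z, by
    rw [hg, map_mul, map_mul, map_pow, map_pow, ← mul_assoc, ← mul_assoc, ← pow_add, ← pow_add,
      Nat.add_sub_cancel' ha, Nat.add_sub_cancel' hb]⟩

include hstar hsu hu0 hu hu' hϖ hs in
/-- **`[K_{m,2m} : K_{m+1,2m+2}] = Q q²`** for `m ≥ 1`. -/
theorem relIndex_congSubgroup_succ (htr : ∃ e : R, algebraMap R E e + star (algebraMap R E e) = 1)
    (m : ℕ) (hm : 1 ≤ m) :
    (congSubgroup hstar u hu0 hu hu' hϖ hs (m + 1) (2 * (m + 1))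
          (Nat.le_mul_of_pos_left (m + 1) Nat.zero_lt_two) le_rfl).relIndex
        (congSubgroup hstar u hu0 hu hu' hϖ hs m (2 * m) (Nat.le_mul_of_pos_left m Nat.zero_lt_two) le_rfl) =
      Nat.card (IsLocalRing.ResidueField R) * Nat.card (traceZero R E) ^ 2 := by
  rw [relIndex_congSubgroup_eq_relIndex_unipCong hstar u hsu hu0 hu hu' hϖ hs hm (Nat.le_succ m)
    (by omega)]
  -- the tower `N_{m,2m} ⊃ N_{m+1,2m} ⊃ N_{m+1,2m+1} ⊃ N_{m+1,2m+2}`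
  have h1 : unipCong hstar u hu' hs (m + 1) (2 * m + 1 + 1) (by omega) ≤
      unipCong hstar u hu' hs (m + 1) (2 * m + 1) (by omega) :=
    unipCong_mono hstar u hu' hs le_rfl (Nat.le_succ _)
  have h2 : unipCong hstar u hu' hs (m + 1) (2 * m + 1) (by omega) ≤
      unipCong hstar u hu' hs (m + 1) (2 * m) (by omega) :=
    unipCong_mono hstar u hu' hs le_rfl (Nat.le_succ _)
  have h3 : unipCong hstar u hu' hs (m + 1) (2 * m) (by omega) ≤
      unipCong hstar u hu' hs m (2 * m) le_rfl :=
    unipCong_mono hstar u hu' hs (Nat.le_succ m) le_rfl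
  show (unipCong hstar u hu' hs (m + 1) (2 * m + 1 + 1) _).relIndex (unipCong hstar u hu' hs m (2 * m) _) = _
  rw [← Subgroup.relIndex_mul_relIndex _ _ _ h1 (h2.trans h3), ← Subgroup.relIndex_mul_relIndex _ _ _ h2 h3,
    relIndex_unipCong_succ_right hstar u hsu hu0 hu' hϖ hs (a := m + 1) (b := 2 * m + 1) (hab := by omega) htr
      (by omega),
    relIndex_unipCong_succ_right hstar u hsu hu0 hu' hϖ hs (a := m + 1) (b := 2 * m) (hab := by omega) htr
      (by omega),
    relIndex_unipCong_succ_left hstar u hsu hu0 hu' hϖ hs (a := m) (b := 2 * m) (hab := le_rfl) htr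
      (by omega)]
  ring

include hstar hsu hu0 hu hu' hϖ hs in
/-- **`[K_{1,1} : K_{1,2}] = q`**. -/
theorem relIndex_congSubgroup_one_two (htr : ∃ e : R, algebraMap R E e + star (algebraMap R E e) = 1) :
    (congSubgroup hstar u hu0 hu hu' hϖ hs 1 2 one_le_two le_rfl).relIndex
        (congSubgroup hstar u hu0 hu hu' hϖ hs 1 1 le_rfl one_le_two) =
      Nat.card (traceZero R E) := by
  rw [relIndex_congSubgroup_eq_relIndex_unipCong hstar u hsu hu0 hu hu' hϖ hs le_rfl le_rfl one_le_two]
  exact relIndex_unipCong_succ_right hstar u hsu hu0 hu' hϖ hs (a := 1) (b := 1) (hab := one_le_two) htr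
    le_rfl

include hstar hsu hu0 hu hu' hϖ hs in
/-- **`[K : K_{n,2n}] = (Q q + 1) · q · (Q q²)^{n−1}`** for `n ≥ 1`. -/
theorem relIndex_congSubgroup_cell [Finite (IsLocalRing.ResidueField R)]
    (htr : ∃ e : R, algebraMap R E e + star (algebraMap R E e) = 1) (n : ℕ) (hn : 1 ≤ n) :
    (congSubgroup hstar u hu0 hu hu' hϖ hs n (2 * n) (Nat.le_mul_of_pos_left n Nat.zero_lt_two)
          le_rfl).relIndex (hyperspecialSubgroup R (J3 u)) =
      (Nat.card (IsLocalRing.ResidueField R) * Nat.card (traceZero R E) + 1) * Nat.card (traceZero R E) *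
        (Nat.card (IsLocalRing.ResidueField R) * Nat.card (traceZero R E) ^ 2) ^ (n - 1) := by
  induction n, hn using Nat.le_induction with
  | base =>
    show (congSubgroup hstar u hu0 hu hu' hϖ hs 1 2 _ _).relIndex (hyperspecialSubgroup R (J3 u)) = _
    rw [← Subgroup.relIndex_mul_relIndex _ (congSubgroup hstar u hu0 hu hu' hϖ hs 1 1 le_rfl one_le_two) _
      (congSubgroup_le hstar u hu0 hu hu' hϖ hs le_rfl one_le_two)
      (congSubgroup_le_hyperspecial hstar u hu0 hu hu' hϖ hs),
      relIndex_congSubgroup_one_two hstar u hsu hu0 hu hu' hϖ hs htr,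
      relIndex_congSubgroup_one_one hstar u hsu hu0 hu hu' hϖ hs htr]
    ring
  | succ m hm ih =>
    rw [← Subgroup.relIndex_mul_relIndex _
      (congSubgroup hstar u hu0 hu hu' hϖ hs m (2 * m) (Nat.le_mul_of_pos_left m Nat.zero_lt_two) le_rfl) _
      (congSubgroup_le hstar u hu0 hu hu' hϖ hs (Nat.le_succ m) (by omega))
      (congSubgroup_le_hyperspecial hstar u hu0 hu hu' hϖ hs),
      relIndex_congSubgroup_succ hstar u hsu hu0 hu hu' hϖ hs htr m hm, ih]
    obtain ⟨k, rfl⟩ : ∃ k, m = k + 1 := ⟨m - 1, by omega⟩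
    rw [show k + 1 + 1 - 1 = k + 1 from rfl, show k + 1 - 1 = k from rfl, pow_succ]
    ring

include hstar hsu hu0 hu hu' hϖ hs in
/-- **THE DEGREE OF THE CELL `K aₙ K`**: `deg Tₙ = #(K aₙ K / K) = (Q q + 1) · q · (Q q²)^{n−1}` for `n ≥ 1`,
`Q = #𝔽`, `q = #{t ∈ 𝔽 : t + t̄ = 0}`. -/
theorem ncard_orbit_cellU_eq [Finite (IsLocalRing.ResidueField R)]
    (htr : ∃ e : R, algebraMap R E e + star (algebraMap R E e) = 1) (n : ℕ) (hn : 1 ≤ n) :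
    (MulAction.orbit (hyperspecialSubgroup R (J3 u))
        ((cellU hϖ hs u n : formUnitaryGroup (J3 u)) :
          formUnitaryGroup (J3 u) ⧸ hyperspecialSubgroup R (J3 u))).ncard =
      (Nat.card (IsLocalRing.ResidueField R) * Nat.card (traceZero R E) + 1) * Nat.card (traceZero R E) *
        (Nat.card (IsLocalRing.ResidueField R) * Nat.card (traceZero R E) ^ 2) ^ (n - 1) := by
  rw [ncard_orbit_cellU_eq_relIndex u hϖ hs n, inf_conjK_cellU_eq_congSubgroup hstar u hu0 hu hu' hϖ hs n,
    relIndex_congSubgroup_cell hstar u hsu hu0 hu hu' hϖ hs htr n hn]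

include hstar hsu hu0 hu hu' hϖ hs in
/-- `deg T₁ = (Q q + 1) q`. -/
theorem ncard_orbit_cellU_one [Finite (IsLocalRing.ResidueField R)]
    (htr : ∃ e : R, algebraMap R E e + star (algebraMap R E e) = 1) :
    (MulAction.orbit (hyperspecialSubgroup R (J3 u))
        ((cellU hϖ hs u 1 : formUnitaryGroup (J3 u)) :
          formUnitaryGroup (J3 u) ⧸ hyperspecialSubgroup R (J3 u))).ncard =
      (Nat.card (IsLocalRing.ResidueField R) * Nat.card (traceZero R E) + 1) * Nat.card (traceZero R E) := by
  rw [ncard_orbit_cellU_eq hstar u hsu hu0 hu hu' hϖ hs htr 1 le_rfl, Nat.sub_self, pow_zero, mul_one]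

include hstar hsu hu0 hu hu' hϖ hs in
/-- **The degree sequence**: `deg T_{n+1} = Q q² · deg Tₙ` for `n ≥ 1`. -/
theorem ncard_orbit_cellU_succ [Finite (IsLocalRing.ResidueField R)]
    (htr : ∃ e : R, algebraMap R E e + star (algebraMap R E e) = 1) (n : ℕ) (hn : 1 ≤ n) :
    (MulAction.orbit (hyperspecialSubgroup R (J3 u))
        ((cellU hϖ hs u (n + 1) : formUnitaryGroup (J3 u)) :
          formUnitaryGroup (J3 u) ⧸ hyperspecialSubgroup R (J3 u))).ncard =
      Nat.card (IsLocalRing.ResidueField R) * Nat.card (traceZero R E) ^ 2 *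
        (MulAction.orbit (hyperspecialSubgroup R (J3 u))
          ((cellU hϖ hs u n : formUnitaryGroup (J3 u)) :
            formUnitaryGroup (J3 u) ⧸ hyperspecialSubgroup R (J3 u))).ncard := by
  rw [ncard_orbit_cellU_eq hstar u hsu hu0 hu hu' hϖ hs htr (n + 1) (by omega),
    ncard_orbit_cellU_eq hstar u hsu hu0 hu hu' hϖ hs htr n hn]
  obtain ⟨k, rfl⟩ : ∃ k, n = k + 1 := ⟨n - 1, by omega⟩
  rw [show k + 1 + 1 - 1 = k + 1 from rfl, show k + 1 - 1 = k from rfl, pow_succ]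
  ring

end Count

end Summit.Ventures.HodgeRepro2.T5InertDegreeCount
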